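import Summits.QuantumFields.YangMills.Theorems.UnitScaleTiltProp7TrueLinIterDefect
import Summits.QuantumFields.YangMills.Theorems.UnitScaleTiltProp7TrueLinIterStructure
import Summits.QuantumFields.YangMills.Theorems.UnitScaleTiltProp7EmlIterULinearPartEqTrueLinIterT3
import HarnessLib

/-!
# Route `UnitScaleTilt`, crux «MinimiserStabilityRegPr» (stmt-QuantumFields-19200, stub EX), positivity block, pen (b1) — THE (iv′)-BRIDGE:
# DEFECT's `ℓ²` ROWS HOLD VERBATIM FOR THE STAIR-GAUGE REDUCED PART `G^{stair}_k := Q_kY − P_{Ū⁽ᵏ⁾}Λ^{stair}_k`, AND FOR px13's `ℓ_kA − P_{Ū⁽ᵏ⁾}Λ_k` AT T³∕SU(2)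

Cell `ym3-torus` (rung R3 — YM₃ on T³; NOT d = 4, NOT infinite volume, NOT a mass gap, NOT the Clay problem).  Width seat `ym-routeR-w4` g25, named for this bridge by the (b) holder
ym-ust-19200-w7 g10 (bus 2026-08-29 21:18:22Z, after ★★OWNER WORD 52 and this seat's LOCATE 21:16:04Z).  THEOREMS ONLY (0 `def`, 0 `sorry`);
`--supports stmt-QuantumFields-19200 --as helper`; count-neutral.  «= the stair-mean re-read of the (R-C) defect row of the 20520 [RP]-curved lane, typed once here; 20520 consumers cite by name.»

THE POINT.  ✓`Prop7TrueLinIterDefect.sqrt_sum_normSq_reduced_sub_lineIter_le` (DEFECT) bounds `ρ‖G_k − S_k‖_{ℓ²}` and `‖G_k‖_{ℓ²}` for the REDUCED recursion family `G`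
(`G_0 = Y`, `G_{j+1}(c) = T_j(G_j)(c) − P_{Ū⁽ʲ⁺¹⁾}(CM_j(G_j))(c)`) whose coarse-site map `CM_j` IS the covariant STAIR mean `|Idx|⁻¹Σ_i covWalkSum Ū⁽ʲ⁾ · (walk (emb z) st_i)`,
`st_i = stairWord i.2.1 (off i.1)` — the same `CM_j` as ✓`Prop7CoarseGaugeEqFrameResponse` (px13 g11, (b1)-(v)).  The (b1) book consumes the reduced part in the OTHER
presentation: `G^{stair}_k := Q_kY − P_{Ū⁽ᵏ⁾}Λ^{stair}_k` with `Λ` the coarse gauge function of the stair mean (`Λ_0 = 0`, `Λ_{j+1}(z) = CM_j(Q_jY − P_{Ū⁽ʲ⁾}Λ_j)(z) + Λ_j(emb z)`)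
and `Q` ANY true-linearisation recursion family (`hQ0 ∕ hQs`).  This file proves that the two presentations AGREE below the target level (`G_j = Q_jY − PΛ_j`, `j ≤ k`: the
structure step of ✓`Prop7TrueLinIterStructure` read backwards — linearity ✓`trueLin_add`, exactness on pure gauges ✓`trueLin_pureGauge`, additivity of `P`), so DEFECT's two rows hold
for `Q_kY − P_{Ū⁽ᵏ⁾}Λ^{stair}_k` with the SAME letters and constants (§1, every `P`, every `SU(N)`, every `M_N(ℂ)` direction), and — by ✓`Prop7EmlIterULinearPartEqTrueLinIter.
fderiv_emlIterU_expUnit_apply_mul_star_eq_trueLinIter` (`ℓ_jA = Q_jA`, `j ≤ K − n`, 𝔰𝔲(2)-valued `A`) — for px13's `ℓ_kA − P_{Ū⁽ᵏ⁾}Λ_k` in the letters of ✓`fderiv_frameAccU_eq_coarseGauge`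
at the d = 3 carrier (§2; tower `V_k := Ū⁽ᵏ⁾[W] = Averaging.iter (blockAvg expMeanLogSU) k W`).  The per-level loop sizes `a j` stay DISPLAYED exactly as DEFECT displays them
(`hα ha24 haN`, `j < k`; the geometric choice `a j = stokes·2ε₀·(Lʲ∕L^{K−n})²` of ✓`tower_plaq_lt` ∘ ✓`dist1_loopHol_le'` makes `Σ_{j<k} a j ≤ stokes·ε₀∕4` k-uniform — the consumer's).

WHAT IS PROVED (ns `…Theorems.Prop7TrueLinIterDefectOfStairGauge`).
* §1 ★★ `sqrt_sum_normSq_gaugeReduced_sub_lineIter_le` — DEFECT's two rows for `G_k := Q_kY − P_{Ū⁽ᵏ⁾}Λ_k` (generic `P`, `SU(N)`; `hΛs` asked only for `j < k`).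
* §2 ★★ `sqrt_sum_normSq_frameReduced_sub_lineIter_le_T3` — the same at `F.P K`, `SU(2)`, `RegPr F n K ε₀ W`, windows `10¹⁰L⁶ε₀ ≤ 1`, `10¹²L³ε₀ ≤ 1`, 𝔰𝔲(2)-valued `A`,
  `k ≤ K − n`, with px13's `ℓ_jA := fderiv ℂ (t ↦ ↑(emlIterU j (eᵗ·W♭) b)) 0 A · (↑Ū⁽ʲ⁾W b)⋆` inside `Λ`'s recursion and in the reduced part.
HONEST SCOPE.  Algebra over landed letters + ONE call of DEFECT; no estimate of print; (iv) `S_k ↔ T^{str}`, `hQcmp`, the γ-row, the print rows, EX and the crux are NOT proved here.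
References: T. Bałaban, CMP **95** (1984) 17–40 [Balaban1984PropagatorsI] ((1.18)–(1.20) pp.19–20); CMP **98** (1985) 17–51 [Balaban1985Averaging] ((11) p.19, Prop. 3 (122)–(127) p.36);
CMP **102** (1985) 277–309 [Balaban1985Variational] (Prop. 7 p.299).
-/

set_option autoImplicit false

noncomputable section

open scoped BigOperators Matrix.Norms.L2Operator

namespace Summit.QuantumFields.YangMills.Theorems.Prop7TrueLinIterDefectOfStairGauge

open Literature.MathematicalPhysics.QuantumFieldTheory.Balaban1983to89
open Literature.MathematicalPhysics.QuantumFieldTheory.Balaban1983to89.T3ContinuumYM3Torus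
open Finset T4Continuum BlockAveraging AveragingRT ExpMeanLog BlockAveragingEMLLinearised BlockAveragingEMLLinearisedBackground BlockAveragingEMLProp2
open Summit.QuantumFields.YangMills.Theorems.Prop7TrueLinPureGauge (trueLin_pureGauge)
open Summit.QuantumFields.YangMills.Theorems.Prop7TrueLinPureGaugeIter (trueLin_add)
open Summit.QuantumFields.YangMills.Theorems.Prop7TrueLinIterStructure (pureGauge_add_apply)
open Summit.QuantumFields.YangMills.Theorems.Prop7TrueLinIterDefect (sqrt_sum_normSq_reduced_sub_lineIter_le)

/-! ## §1 ★★ DEFECT's rows for the stair-gauge reduced part `Q_kY − P_{Ū⁽ᵏ⁾}Λ_k` (generic `P`, `SU(N)`) -/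

section Generic

variable {P : Params} {n : Type*} [Fintype n] [DecidableEq n] [Nonempty n]

/-- ★★ **DEFECT's TWO `ℓ²` ROWS FOR THE STAIR-GAUGE REDUCED PART.**  Tower `Ū⁽ʲ⁾ = Averaging.iter (blockAvg ℰp) j U₀`; `Q` any recursion family of the written-out true one-step
linearisations (`hQ0 ∕ hQs`, the letters of ✓`Prop7TrueLinIterStructure.trueLinIter_structure` VERBATIM); `Λ` the coarse gauge function OF THE STAIR MEAN (`hΛ0`, `hΛs` for the levels
`j < k`: `Λ_{j+1}(z) = |Idx|⁻¹·Σ_i covWalkSum Ū⁽ʲ⁾ (Q_jY − P_{Ū⁽ʲ⁾}Λ_j) (walk (emb z) st_i) + Λ_j(emb z)`); `S` the pure `LINE` iterate (`hS0 ∕ hSs`, DEFECT's letters VERBATIM); loop sizes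
`a j` displayed as in DEFECT.  Then DEFECT's conclusion holds with `G k c` READ AS `Q k Y c − (Λ k c₋ − Ū⁽ᵏ⁾(c)·Λ k c₊·Ū⁽ᵏ⁾(c)⋆)`:
`ρ·√(Σ_c‖(Q_kY − PΛ_k)(c) − S k c‖²) ≤ ρ^k·κ·(Σ_{j<k} a j)·exp((κ∕ρ)Σ_{j<k} a j)·√(Σ_b‖Y b‖²)` and `√(Σ_c‖(Q_kY − PΛ_k)(c)‖²) ≤ ρ^k·exp((κ∕ρ)Σ_{j<k} a j)·√(Σ_b‖Y b‖²)`,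
`ρ = √((L^d)⁻¹L²)`, `κ = 159(d+2)L·√((2dL^d)(2d))`.  Proof: the reduced recursion family `G` of DEFECT (built by `Nat.rec`) satisfies `G_j = Q_jY − P_{Ū⁽ʲ⁾}Λ_j` for `j ≤ k`
(✓`trueLin_add`, ✓`trueLin_pureGauge` under the guard `a j < δ_N`, ✓`pureGauge_add_apply`), then ONE call of ✓`sqrt_sum_normSq_reduced_sub_lineIter_le`.
[cite: Balaban1984PropagatorsI, (1.18)-(1.20) pp.19-20; Balaban1985Averaging, Prop. 3 (124)-(126) p.36] -/
theorem sqrt_sum_normSq_gaugeReduced_sub_lineIter_le (U₀ : GaugeField P 0 (Matrix.specialUnitaryGroup n ℂ)) (Y : PBond P 0 → Matrix n n ℂ)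
    (Q : (k : ℕ) → (PBond P 0 → Matrix n n ℂ) → PBond P k → Matrix n n ℂ) (hQ0 : ∀ Y, Q 0 Y = Y)
    (hQs : ∀ (k : ℕ) (Y : PBond P 0 → Matrix n n ℂ) (c : PBond P (k + 1)), Q (k + 1) Y c
      = (fderiv ℂ (eml : (Idx P → Matrix n n ℂ) → Matrix n n ℂ)
            (fun i => ((loopHol (Averaging.iter (fun i => blockAvg (P := P) (j := i) (expMeanLogSU (n := n))) k U₀) c i : Matrix.specialUnitaryGroup n ℂ) : Matrix n n ℂ))
            (fun i => covWalkSum (Averaging.iter (fun i => blockAvg (P := P) (j := i) (expMeanLogSU (n := n))) k U₀) (Q k Y)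
                (walk (emb c.src) (loopWord P.L c.dir (off i.1) i.2.1 i.2.2))
              * ((loopHol (Averaging.iter (fun i => blockAvg (P := P) (j := i) (expMeanLogSU (n := n))) k U₀) c i : Matrix.specialUnitaryGroup n ℂ) : Matrix n n ℂ))
            * star ((corr (expMeanLogSU (n := n)) (Averaging.iter (fun i => blockAvg (P := P) (j := i) (expMeanLogSU (n := n))) k U₀) c : Matrix.specialUnitaryGroup n ℂ) : Matrix n n ℂ)
          + ((corr (expMeanLogSU (n := n)) (Averaging.iter (fun i => blockAvg (P := P) (j := i) (expMeanLogSU (n := n))) k U₀) c : Matrix.specialUnitaryGroup n ℂ) : Matrix n n ℂ)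
            * covWalkSum (Averaging.iter (fun i => blockAvg (P := P) (j := i) (expMeanLogSU (n := n))) k U₀) (Q k Y)
                (walk (emb c.src) (List.replicate P.L (c.dir, true)))
            * star ((corr (expMeanLogSU (n := n)) (Averaging.iter (fun i => blockAvg (P := P) (j := i) (expMeanLogSU (n := n))) k U₀) c : Matrix.specialUnitaryGroup n ℂ) : Matrix n n ℂ)))
    (Λ : (k : ℕ) → Site P k → Matrix n n ℂ) (hΛ0 : ∀ x, Λ 0 x = 0)
    (S : (k : ℕ) → PBond P k → Matrix n n ℂ) (hS0 : ∀ b, S 0 b = Y b)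
    (hSs : ∀ (k : ℕ) (c : PBond P (k + 1)), S (k + 1) c
      = ((Fintype.card (Idx P) : ℂ))⁻¹ • ∑ i : Idx P,
          (((holAt (Averaging.iter (fun i => blockAvg (P := P) (j := i) (expMeanLogSU (n := n))) k U₀) (walk (emb c.src) (stairWord i.2.1 (off i.1))) : Matrix.specialUnitaryGroup n ℂ) : Matrix n n ℂ) *
            covWalkSum (Averaging.iter (fun i => blockAvg (P := P) (j := i) (expMeanLogSU (n := n))) k U₀) (S k)
              (walk (walkEnd (emb c.src) (stairWord i.2.1 (off i.1))) (List.replicate P.L (c.dir, true))) *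
          star ((holAt (Averaging.iter (fun i => blockAvg (P := P) (j := i) (expMeanLogSU (n := n))) k U₀) (walk (emb c.src) (stairWord i.2.1 (off i.1))) : Matrix.specialUnitaryGroup n ℂ) : Matrix n n ℂ)))
    (a : ℕ → ℝ) (ha0 : ∀ j, 0 ≤ a j) {k : ℕ} (hk : k ≤ P.m + P.K)
    (hΛs : ∀ j < k, ∀ z : Site P (j + 1), Λ (j + 1) z
      = ((Fintype.card (Idx P) : ℂ))⁻¹ • (∑ i : Idx P,
          covWalkSum (Averaging.iter (fun i => blockAvg (P := P) (j := i) (expMeanLogSU (n := n))) j U₀) (fun b => Q j Y b - (Λ j b.src - ((Averaging.iter (fun i => blockAvg (P := P) (j := i) (expMeanLogSU (n := n))) j U₀ b : Matrix.specialUnitaryGroup n ℂ) : Matrix n n ℂ) * Λ j b.tgt * star ((Averaging.iter (fun i => blockAvg (P := P) (j := i) (expMeanLogSU (n := n))) j U₀ b : Matrix.specialUnitaryGroup n ℂ) : Matrix n n ℂ)))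
            (walk (emb z) (stairWord i.2.1 (off i.1))))
        + Λ j (emb z))
    (hα : ∀ j < k, ∀ (c : PBond P (j + 1)) (i : Idx P),
        dist1 (loopHol (Averaging.iter (fun i => blockAvg (P := P) (j := i) (expMeanLogSU (n := n))) j U₀) c i) ≤ a j)
    (ha24 : ∀ j < k, a j ≤ 1 / 24) (haN : ∀ j < k, a j < deltaSU n) :
    Real.sqrt (((P.L : ℝ) ^ P.d)⁻¹ * (P.L : ℝ) ^ 2) * Real.sqrt (∑ c : PBond P k, ‖(Q k Y c - (Λ k c.src - ((Averaging.iter (fun i => blockAvg (P := P) (j := i) (expMeanLogSU (n := n))) k U₀ c : Matrix.specialUnitaryGroup n ℂ) : Matrix n n ℂ) * Λ k c.tgt * star ((Averaging.iter (fun i => blockAvg (P := P) (j := i) (expMeanLogSU (n := n))) k U₀ c : Matrix.specialUnitaryGroup n ℂ) : Matrix n n ℂ))) - S k c‖ ^ 2)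
        ≤ Real.sqrt (((P.L : ℝ) ^ P.d)⁻¹ * (P.L : ℝ) ^ 2) ^ k * (159 * (((P.d + 2) * P.L : ℕ) : ℝ) * Real.sqrt (2 * P.d * (P.L : ℝ) ^ P.d * (2 * P.d)))
          * (∑ j ∈ Finset.range k, a j) * Real.exp ((159 * (((P.d + 2) * P.L : ℕ) : ℝ) * Real.sqrt (2 * P.d * (P.L : ℝ) ^ P.d * (2 * P.d)))
              / Real.sqrt (((P.L : ℝ) ^ P.d)⁻¹ * (P.L : ℝ) ^ 2) * ∑ j ∈ Finset.range k, a j) * Real.sqrt (∑ b : PBond P 0, ‖Y b‖ ^ 2)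
      ∧ Real.sqrt (∑ c : PBond P k, ‖(Q k Y c - (Λ k c.src - ((Averaging.iter (fun i => blockAvg (P := P) (j := i) (expMeanLogSU (n := n))) k U₀ c : Matrix.specialUnitaryGroup n ℂ) : Matrix n n ℂ) * Λ k c.tgt * star ((Averaging.iter (fun i => blockAvg (P := P) (j := i) (expMeanLogSU (n := n))) k U₀ c : Matrix.specialUnitaryGroup n ℂ) : Matrix n n ℂ)))‖ ^ 2)
        ≤ Real.sqrt (((P.L : ℝ) ^ P.d)⁻¹ * (P.L : ℝ) ^ 2) ^ k * Real.exp ((159 * (((P.d + 2) * P.L : ℕ) : ℝ) * Real.sqrt (2 * P.d * (P.L : ℝ) ^ P.d * (2 * P.d)))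
              / Real.sqrt (((P.L : ℝ) ^ P.d)⁻¹ * (P.L : ℝ) ^ 2) * ∑ j ∈ Finset.range k, a j) * Real.sqrt (∑ b : PBond P 0, ‖Y b‖ ^ 2) := by
  classical
  -- DEFECT's reduced recursion family, built by `Nat.rec` (one-step operator `T_j` and the subtracted coarse pure gauge `P(CM_j ·)` written out)
  let T : (j : ℕ) → (PBond P j → Matrix n n ℂ) → PBond P (j + 1) → Matrix n n ℂ := fun j Z c =>
    (fderiv ℂ (eml : (Idx P → Matrix n n ℂ) → Matrix n n ℂ)
            (fun i => ((loopHol (Averaging.iter (fun i => blockAvg (P := P) (j := i) (expMeanLogSU (n := n))) j U₀) c i : Matrix.specialUnitaryGroup n ℂ) : Matrix n n ℂ))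
            (fun i => covWalkSum (Averaging.iter (fun i => blockAvg (P := P) (j := i) (expMeanLogSU (n := n))) j U₀) Z
                (walk (emb c.src) (loopWord P.L c.dir (off i.1) i.2.1 i.2.2))
              * ((loopHol (Averaging.iter (fun i => blockAvg (P := P) (j := i) (expMeanLogSU (n := n))) j U₀) c i : Matrix.specialUnitaryGroup n ℂ) : Matrix n n ℂ))
            * star ((corr (expMeanLogSU (n := n)) (Averaging.iter (fun i => blockAvg (P := P) (j := i) (expMeanLogSU (n := n))) j U₀) c : Matrix.specialUnitaryGroup n ℂ) : Matrix n n ℂ)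
          + ((corr (expMeanLogSU (n := n)) (Averaging.iter (fun i => blockAvg (P := P) (j := i) (expMeanLogSU (n := n))) j U₀) c : Matrix.specialUnitaryGroup n ℂ) : Matrix n n ℂ)
            * covWalkSum (Averaging.iter (fun i => blockAvg (P := P) (j := i) (expMeanLogSU (n := n))) j U₀) Z
                (walk (emb c.src) (List.replicate P.L (c.dir, true)))
            * star ((corr (expMeanLogSU (n := n)) (Averaging.iter (fun i => blockAvg (P := P) (j := i) (expMeanLogSU (n := n))) j U₀) c : Matrix.specialUnitaryGroup n ℂ) : Matrix n n ℂ))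
  let CP : (j : ℕ) → (PBond P j → Matrix n n ℂ) → PBond P (j + 1) → Matrix n n ℂ := fun j Z c =>
    ((((Fintype.card (Idx P) : ℂ))⁻¹ • ∑ i : Idx P,
              covWalkSum (Averaging.iter (fun i => blockAvg (P := P) (j := i) (expMeanLogSU (n := n))) j U₀) Z (walk (emb c.src) (stairWord i.2.1 (off i.1))))
            - ((Averaging.iter (fun i => blockAvg (P := P) (j := i) (expMeanLogSU (n := n))) (j + 1) U₀ c : Matrix.specialUnitaryGroup n ℂ) : Matrix n n ℂ)
              * (((Fintype.card (Idx P) : ℂ))⁻¹ • ∑ i : Idx P,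
                  covWalkSum (Averaging.iter (fun i => blockAvg (P := P) (j := i) (expMeanLogSU (n := n))) j U₀) Z (walk (emb c.tgt) (stairWord i.2.1 (off i.1))))
              * star ((Averaging.iter (fun i => blockAvg (P := P) (j := i) (expMeanLogSU (n := n))) (j + 1) U₀ c : Matrix.specialUnitaryGroup n ℂ) : Matrix n n ℂ))
  let G : (j : ℕ) → PBond P j → Matrix n n ℂ := fun j =>
    Nat.rec (motive := fun j => PBond P j → Matrix n n ℂ) Y (fun j g => fun c => T j g c - CP j g c) j
  have hG0 : ∀ b, G 0 b = Y b := fun b => rfl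
  have hGs : ∀ (j : ℕ) (c : PBond P (j + 1)), G (j + 1) c = T j (G j) c - CP j (G j) c := fun j c => rfl
  -- the identification `G_j = Q_jY − P_{Ū⁽ʲ⁾}Λ_j` for `j ≤ k` (STRUCTURE's step read backwards)
  have hGQ : ∀ j ≤ k, ∀ c : PBond P j, G j c = Q j Y c - (Λ j c.src - ((Averaging.iter (fun i => blockAvg (P := P) (j := i) (expMeanLogSU (n := n))) j U₀ c : Matrix.specialUnitaryGroup n ℂ) : Matrix n n ℂ) * Λ j c.tgt * star ((Averaging.iter (fun i => blockAvg (P := P) (j := i) (expMeanLogSU (n := n))) j U₀ c : Matrix.specialUnitaryGroup n ℂ) : Matrix n n ℂ)) := by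
    intro j
    induction j with
    | zero =>
      intro _ c
      rw [hG0, hQ0, hΛ0, hΛ0, mul_zero, zero_mul, sub_zero, sub_zero]
    | succ j ih =>
      intro hj c
      have hj' : j < k := hj
      have ihf : (fun b : PBond P j => Q j Y b - (Λ j b.src - ((Averaging.iter (fun i => blockAvg (P := P) (j := i) (expMeanLogSU (n := n))) j U₀ b : Matrix.specialUnitaryGroup n ℂ) : Matrix n n ℂ) * Λ j b.tgt * star ((Averaging.iter (fun i => blockAvg (P := P) (j := i) (expMeanLogSU (n := n))) j U₀ b : Matrix.specialUnitaryGroup n ℂ) : Matrix n n ℂ))) = G j :=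
        funext fun b => (ih hj'.le b).symm
      have hsplit : Q j Y = G j + fun b : PBond P j => (Λ j b.src - ((Averaging.iter (fun i => blockAvg (P := P) (j := i) (expMeanLogSU (n := n))) j U₀ b : Matrix.specialUnitaryGroup n ℂ) : Matrix n n ℂ) * Λ j b.tgt * star ((Averaging.iter (fun i => blockAvg (P := P) (j := i) (expMeanLogSU (n := n))) j U₀ b : Matrix.specialUnitaryGroup n ℂ) : Matrix n n ℂ)) := by
        funext b; rw [Pi.add_apply, ih hj'.le b, sub_add_cancel]
      have hit : Averaging.iter (fun i => blockAvg (P := P) (j := i) (expMeanLogSU (n := n))) (j + 1) U₀ = avgFun (expMeanLogSU (n := n)) (Averaging.iter (fun i => blockAvg (P := P) (j := i) (expMeanLogSU (n := n))) j U₀) := rfl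
      rw [hGs, hQs j Y c, hsplit, trueLin_add, trueLin_pureGauge (Averaging.iter (fun i => blockAvg (P := P) (j := i) (expMeanLogSU (n := n))) j U₀) (Λ j) c
        (fun i => (hα j hj' c i).trans_lt (haN j hj')), hΛs j hj' c.src, hΛs j hj' c.tgt, ihf]
      simp only [T, CP, ← hit]
      noncomm_ring
  -- ONE call of DEFECT on `G`, then the identification at the target level
  have hD := sqrt_sum_normSq_reduced_sub_lineIter_le U₀ Y G S hG0 hS0 (fun j c => rfl) hSs a ha0 hk hα ha24 haN
  simpa only [hGQ k le_rfl] using hD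

end Generic


/-! ## §2 ★★ The d = 3 member in px13's letters: `ℓ_kA − P_{Ū⁽ᵏ⁾}Λ_k` at `RegPr F n K ε₀ W`, 𝔰𝔲(2)-valued `A`, `k ≤ K − n` -/

section T3

open T3PrintedRegularMinimiser (RegPr)
open T3RegularMinimiser (regThreshold)
open Summit.QuantumFields.YangMills.Theorems.Prop7CovIterLambdaBound (tower_plaq_lt)
open T3SectALandauChart (bgUnits)
open B7Prop1Explicit (expUnit)
open Summit.QuantumFields.YangMills.Theorems.Prop8Chart (emlIterU)
open Summit.QuantumFields.YangMills.Theorems.Prop7EmlIterULinearPartEqTrueLinIter (fderiv_emlIterU_expUnit_apply_mul_star_eq_trueLinIter)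

variable (F : T3Family) {n K : ℕ}

/-- ★★ **DEFECT's TWO ROWS FOR px13's FRAME-RESPONSE REDUCED PART `ℓ_kA − P_{Ū⁽ᵏ⁾}Λ_k` AT THE d = 3 CARRIER.**  `F` a T³ family, `0 < ε₀`, `10¹⁰L⁶ε₀ ≤ 1`, `10¹²L³ε₀ ≤ 1`, `W` printed-regular
(`RegPr F n K ε₀ W`), `Q` ANY true-linearisation recursion family along `W`'s tower (`hQ0 ∕ hQs`, the letters of ✓`QSym_apply_eq_trueLinIter` ∕ DEFECT VERBATIM), `A` an 𝔰𝔲(2)-valued bond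
field, `Λ` the STAIR-MEAN coarse gauge family in the letters of ✓`Prop7CoarseGaugeEqFrameResponse.fderiv_frameAccU_eq_coarseGauge` with `V k := Ū⁽ᵏ⁾[W] = Averaging.iter (blockAvg expMeanLogSU) k W`
(`hΛ0`, `hΛs` for `k + 1 ≤ K − n`, `ℓ_kA b := fderiv ℂ (t ↦ ↑(emlIterU k (eᵗ·W♭) b)) 0 A · (↑Ū⁽ᵏ⁾W b)⋆` inside), `S` the pure `LINE` iterate (DEFECT's `hS0 ∕ hSs`), loop sizes `a j` displayed
as in DEFECT, target level `k ≤ K − n`.  Then DEFECT's conclusion holds with `G k c` READ AS `ℓ_kA c − (Λ k c₋ − Ū⁽ᵏ⁾(c)·Λ k c₊·Ū⁽ᵏ⁾(c)⋆)`.  Proof: `ℓ_jA = Q_jA` for `j ≤ K − n`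
(✓`fderiv_emlIterU_expUnit_apply_mul_star_eq_trueLinIter`), so `Λ` satisfies §1's recursion below `k`, and §1 applies (`k ≤ m + K` from `k ≤ K − n`).
[cite: Balaban1985Averaging, (11) p.19, Prop. 3 (122)-(127) p.36; Balaban1984PropagatorsI, (1.18)-(1.20) pp.19-20] -/
theorem sqrt_sum_normSq_frameReduced_sub_lineIter_le_T3 {ε₀ : ℝ} (hε₀ : 0 < ε₀) (hε : 10 ^ 10 * (F.L : ℝ) ^ 6 * ε₀ ≤ 1)
    (hε12 : 10 ^ 12 * (F.L : ℝ) ^ 3 * ε₀ ≤ 1)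
    (W : GaugeField (F.P K) 0 (Matrix.specialUnitaryGroup (Fin 2) ℂ)) (hreg : RegPr F n K ε₀ W)
    (Q : (k : ℕ) → (PBond (F.P K) 0 → Matrix (Fin 2) (Fin 2) ℂ) → PBond (F.P K) k → Matrix (Fin 2) (Fin 2) ℂ) (hQ0 : ∀ Y, Q 0 Y = Y)
    (hQs : ∀ (k : ℕ) (Y : PBond (F.P K) 0 → Matrix (Fin 2) (Fin 2) ℂ) (c : PBond (F.P K) (k + 1)), Q (k + 1) Y c
      = (fderiv ℂ (eml : (Idx (F.P K) → Matrix (Fin 2) (Fin 2) ℂ) → Matrix (Fin 2) (Fin 2) ℂ)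
            (fun i => ((loopHol (Averaging.iter (fun i => blockAvg (P := F.P K) (j := i) (expMeanLogSU (n := Fin 2))) k W) c i : Matrix.specialUnitaryGroup (Fin 2) ℂ) : Matrix (Fin 2) (Fin 2) ℂ))
            (fun i => covWalkSum (Averaging.iter (fun i => blockAvg (P := F.P K) (j := i) (expMeanLogSU (n := Fin 2))) k W) (Q k Y)
                (walk (emb c.src) (loopWord (F.P K).L c.dir (off i.1) i.2.1 i.2.2))
              * ((loopHol (Averaging.iter (fun i => blockAvg (P := F.P K) (j := i) (expMeanLogSU (n := Fin 2))) k W) c i : Matrix.specialUnitaryGroup (Fin 2) ℂ) : Matrix (Fin 2) (Fin 2) ℂ))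
            * star ((corr (expMeanLogSU (n := Fin 2)) (Averaging.iter (fun i => blockAvg (P := F.P K) (j := i) (expMeanLogSU (n := Fin 2))) k W) c : Matrix.specialUnitaryGroup (Fin 2) ℂ) : Matrix (Fin 2) (Fin 2) ℂ)
          + ((corr (expMeanLogSU (n := Fin 2)) (Averaging.iter (fun i => blockAvg (P := F.P K) (j := i) (expMeanLogSU (n := Fin 2))) k W) c : Matrix.specialUnitaryGroup (Fin 2) ℂ) : Matrix (Fin 2) (Fin 2) ℂ)
            * covWalkSum (Averaging.iter (fun i => blockAvg (P := F.P K) (j := i) (expMeanLogSU (n := Fin 2))) k W) (Q k Y)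
                (walk (emb c.src) (List.replicate (F.P K).L (c.dir, true)))
            * star ((corr (expMeanLogSU (n := Fin 2)) (Averaging.iter (fun i => blockAvg (P := F.P K) (j := i) (expMeanLogSU (n := Fin 2))) k W) c : Matrix.specialUnitaryGroup (Fin 2) ℂ) : Matrix (Fin 2) (Fin 2) ℂ)))
    (A : PBond (F.P K) 0 → Matrix (Fin 2) (Fin 2) ℂ) (hA : ∀ b, A b ∈ skewAdjoint (Matrix (Fin 2) (Fin 2) ℂ)) (htr : ∀ b, (A b).trace = 0)
    (Λ : (k : ℕ) → Site (F.P K) k → Matrix (Fin 2) (Fin 2) ℂ) (hΛ0 : ∀ x, Λ 0 x = 0)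
    (hΛs : ∀ (k : ℕ), k + 1 ≤ K - n → ∀ y : Site (F.P K) (k + 1),
      Λ (k + 1) y = (Fintype.card (Idx (F.P K)) : ℂ)⁻¹ • (∑ i : Idx (F.P K),
          covWalkSum (Averaging.iter (fun i => blockAvg (P := F.P K) (j := i) (expMeanLogSU (n := Fin 2))) k W)
            (fun b => (fderiv ℂ (fun t : PBond (F.P K) 0 → Matrix (Fin 2) (Fin 2) ℂ =>
                ((emlIterU k (fun b' => expUnit (t b') * bgUnits F K W b') b : (Matrix (Fin 2) (Fin 2) ℂ)ˣ) : Matrix (Fin 2) (Fin 2) ℂ)) 0 A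
              * star ((Averaging.iter (fun i => blockAvg (P := F.P K) (j := i) (expMeanLogSU (n := Fin 2))) k W b : Matrix.specialUnitaryGroup (Fin 2) ℂ) : Matrix (Fin 2) (Fin 2) ℂ))
              - (Λ k b.src - ((Averaging.iter (fun i => blockAvg (P := F.P K) (j := i) (expMeanLogSU (n := Fin 2))) k W b : Matrix.specialUnitaryGroup (Fin 2) ℂ) : Matrix (Fin 2) (Fin 2) ℂ) * Λ k b.tgt * star ((Averaging.iter (fun i => blockAvg (P := F.P K) (j := i) (expMeanLogSU (n := Fin 2))) k W b : Matrix.specialUnitaryGroup (Fin 2) ℂ) : Matrix (Fin 2) (Fin 2) ℂ)))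
            (walk (emb y) (stairWord i.2.1 (off i.1))))
        + Λ k (emb y))
    (S : (k : ℕ) → PBond (F.P K) k → Matrix (Fin 2) (Fin 2) ℂ) (hS0 : ∀ b, S 0 b = A b)
    (hSs : ∀ (k : ℕ) (c : PBond (F.P K) (k + 1)), S (k + 1) c
      = ((Fintype.card (Idx (F.P K)) : ℂ))⁻¹ • ∑ i : Idx (F.P K),
          (((holAt (Averaging.iter (fun i => blockAvg (P := F.P K) (j := i) (expMeanLogSU (n := Fin 2))) k W) (walk (emb c.src) (stairWord i.2.1 (off i.1))) : Matrix.specialUnitaryGroup (Fin 2) ℂ) : Matrix (Fin 2) (Fin 2) ℂ) *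
            covWalkSum (Averaging.iter (fun i => blockAvg (P := F.P K) (j := i) (expMeanLogSU (n := Fin 2))) k W) (S k)
              (walk (walkEnd (emb c.src) (stairWord i.2.1 (off i.1))) (List.replicate (F.P K).L (c.dir, true))) *
          star ((holAt (Averaging.iter (fun i => blockAvg (P := F.P K) (j := i) (expMeanLogSU (n := Fin 2))) k W) (walk (emb c.src) (stairWord i.2.1 (off i.1))) : Matrix.specialUnitaryGroup (Fin 2) ℂ) : Matrix (Fin 2) (Fin 2) ℂ)))
    (a : ℕ → ℝ) (ha0 : ∀ j, 0 ≤ a j) {k : ℕ} (hk : k ≤ K - n)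
    (hα : ∀ j < k, ∀ (c : PBond (F.P K) (j + 1)) (i : Idx (F.P K)),
        dist1 (loopHol (Averaging.iter (fun i => blockAvg (P := F.P K) (j := i) (expMeanLogSU (n := Fin 2))) j W) c i) ≤ a j)
    (ha24 : ∀ j < k, a j ≤ 1 / 24) (haN : ∀ j < k, a j < deltaSU (Fin 2)) :
    Real.sqrt ((((F.P K).L : ℝ) ^ (F.P K).d)⁻¹ * ((F.P K).L : ℝ) ^ 2) * Real.sqrt (∑ c : PBond (F.P K) k, ‖((fderiv ℂ (fun t : PBond (F.P K) 0 → Matrix (Fin 2) (Fin 2) ℂ =>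
                ((emlIterU k (fun b' => expUnit (t b') * bgUnits F K W b') c : (Matrix (Fin 2) (Fin 2) ℂ)ˣ) : Matrix (Fin 2) (Fin 2) ℂ)) 0 A
              * star ((Averaging.iter (fun i => blockAvg (P := F.P K) (j := i) (expMeanLogSU (n := Fin 2))) k W c : Matrix.specialUnitaryGroup (Fin 2) ℂ) : Matrix (Fin 2) (Fin 2) ℂ)) - (Λ k c.src - ((Averaging.iter (fun i => blockAvg (P := F.P K) (j := i) (expMeanLogSU (n := Fin 2))) k W c : Matrix.specialUnitaryGroup (Fin 2) ℂ) : Matrix (Fin 2) (Fin 2) ℂ) * Λ k c.tgt * star ((Averaging.iter (fun i => blockAvg (P := F.P K) (j := i) (expMeanLogSU (n := Fin 2))) k W c : Matrix.specialUnitaryGroup (Fin 2) ℂ) : Matrix (Fin 2) (Fin 2) ℂ))) - S k c‖ ^ 2)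
        ≤ Real.sqrt ((((F.P K).L : ℝ) ^ (F.P K).d)⁻¹ * ((F.P K).L : ℝ) ^ 2) ^ k * (159 * ((((F.P K).d + 2) * (F.P K).L : ℕ) : ℝ) * Real.sqrt (2 * (F.P K).d * ((F.P K).L : ℝ) ^ (F.P K).d * (2 * (F.P K).d)))
          * (∑ j ∈ Finset.range k, a j) * Real.exp ((159 * ((((F.P K).d + 2) * (F.P K).L : ℕ) : ℝ) * Real.sqrt (2 * (F.P K).d * ((F.P K).L : ℝ) ^ (F.P K).d * (2 * (F.P K).d)))
              / Real.sqrt ((((F.P K).L : ℝ) ^ (F.P K).d)⁻¹ * ((F.P K).L : ℝ) ^ 2) * ∑ j ∈ Finset.range k, a j) * Real.sqrt (∑ b : PBond (F.P K) 0, ‖A b‖ ^ 2)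
      ∧ Real.sqrt (∑ c : PBond (F.P K) k, ‖((fderiv ℂ (fun t : PBond (F.P K) 0 → Matrix (Fin 2) (Fin 2) ℂ =>
                ((emlIterU k (fun b' => expUnit (t b') * bgUnits F K W b') c : (Matrix (Fin 2) (Fin 2) ℂ)ˣ) : Matrix (Fin 2) (Fin 2) ℂ)) 0 A
              * star ((Averaging.iter (fun i => blockAvg (P := F.P K) (j := i) (expMeanLogSU (n := Fin 2))) k W c : Matrix.specialUnitaryGroup (Fin 2) ℂ) : Matrix (Fin 2) (Fin 2) ℂ)) - (Λ k c.src - ((Averaging.iter (fun i => blockAvg (P := F.P K) (j := i) (expMeanLogSU (n := Fin 2))) k W c : Matrix.specialUnitaryGroup (Fin 2) ℂ) : Matrix (Fin 2) (Fin 2) ℂ) * Λ k c.tgt * star ((Averaging.iter (fun i => blockAvg (P := F.P K) (j := i) (expMeanLogSU (n := Fin 2))) k W c : Matrix.specialUnitaryGroup (Fin 2) ℂ) : Matrix (Fin 2) (Fin 2) ℂ)))‖ ^ 2)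
        ≤ Real.sqrt ((((F.P K).L : ℝ) ^ (F.P K).d)⁻¹ * ((F.P K).L : ℝ) ^ 2) ^ k * Real.exp ((159 * ((((F.P K).d + 2) * (F.P K).L : ℕ) : ℝ) * Real.sqrt (2 * (F.P K).d * ((F.P K).L : ℝ) ^ (F.P K).d * (2 * (F.P K).d)))
              / Real.sqrt ((((F.P K).L : ℝ) ^ (F.P K).d)⁻¹ * ((F.P K).L : ℝ) ^ 2) * ∑ j ∈ Finset.range k, a j) * Real.sqrt (∑ b : PBond (F.P K) 0, ‖A b‖ ^ 2) := by
  -- standing range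
  have hkst : k ≤ (F.P K).m + (F.P K).K := by
    have h1 : K - n ≤ (F.P K).m + (F.P K).K := by show K - n ≤ F.m + K; omega
    exact hk.trans h1
  -- `ℓ_jA = Q_jA` at every level `j ≤ K − n` (the chain rule of ✓`…EmlIterULinearPartEqTrueLinIter`)
  have hℓ : ∀ j, j ≤ K - n → ∀ b : PBond (F.P K) j,
      (fderiv ℂ (fun t : PBond (F.P K) 0 → Matrix (Fin 2) (Fin 2) ℂ =>
                ((emlIterU j (fun b' => expUnit (t b') * bgUnits F K W b') b : (Matrix (Fin 2) (Fin 2) ℂ)ˣ) : Matrix (Fin 2) (Fin 2) ℂ)) 0 A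
              * star ((Averaging.iter (fun i => blockAvg (P := F.P K) (j := i) (expMeanLogSU (n := Fin 2))) j W b : Matrix.specialUnitaryGroup (Fin 2) ℂ) : Matrix (Fin 2) (Fin 2) ℂ)) = Q j A b :=
    fun j hj b => fderiv_emlIterU_expUnit_apply_mul_star_eq_trueLinIter F hε₀ hε hε12 W hreg Q hQ0 hQs A hA htr hj b
  -- hence `Λ` obeys §1's recursion below `k`
  have hΛs' : ∀ j < k, ∀ z : Site (F.P K) (j + 1), Λ (j + 1) z
      = ((Fintype.card (Idx (F.P K)) : ℂ))⁻¹ • (∑ i : Idx (F.P K),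
          covWalkSum (Averaging.iter (fun i => blockAvg (P := F.P K) (j := i) (expMeanLogSU (n := Fin 2))) j W) (fun b => Q j A b - (Λ j b.src - ((Averaging.iter (fun i => blockAvg (P := F.P K) (j := i) (expMeanLogSU (n := Fin 2))) j W b : Matrix.specialUnitaryGroup (Fin 2) ℂ) : Matrix (Fin 2) (Fin 2) ℂ) * Λ j b.tgt * star ((Averaging.iter (fun i => blockAvg (P := F.P K) (j := i) (expMeanLogSU (n := Fin 2))) j W b : Matrix.specialUnitaryGroup (Fin 2) ℂ) : Matrix (Fin 2) (Fin 2) ℂ)))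
            (walk (emb z) (stairWord i.2.1 (off i.1))))
        + Λ j (emb z) := by
    intro j hj z
    have hfun : (fun b : PBond (F.P K) j => (fderiv ℂ (fun t : PBond (F.P K) 0 → Matrix (Fin 2) (Fin 2) ℂ =>
                ((emlIterU j (fun b' => expUnit (t b') * bgUnits F K W b') b : (Matrix (Fin 2) (Fin 2) ℂ)ˣ) : Matrix (Fin 2) (Fin 2) ℂ)) 0 A
              * star ((Averaging.iter (fun i => blockAvg (P := F.P K) (j := i) (expMeanLogSU (n := Fin 2))) j W b : Matrix.specialUnitaryGroup (Fin 2) ℂ) : Matrix (Fin 2) (Fin 2) ℂ))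
          - (Λ j b.src - ((Averaging.iter (fun i => blockAvg (P := F.P K) (j := i) (expMeanLogSU (n := Fin 2))) j W b : Matrix.specialUnitaryGroup (Fin 2) ℂ) : Matrix (Fin 2) (Fin 2) ℂ) * Λ j b.tgt * star ((Averaging.iter (fun i => blockAvg (P := F.P K) (j := i) (expMeanLogSU (n := Fin 2))) j W b : Matrix.specialUnitaryGroup (Fin 2) ℂ) : Matrix (Fin 2) (Fin 2) ℂ)))
        = fun b : PBond (F.P K) j => Q j A b - (Λ j b.src - ((Averaging.iter (fun i => blockAvg (P := F.P K) (j := i) (expMeanLogSU (n := Fin 2))) j W b : Matrix.specialUnitaryGroup (Fin 2) ℂ) : Matrix (Fin 2) (Fin 2) ℂ) * Λ j b.tgt * star ((Averaging.iter (fun i => blockAvg (P := F.P K) (j := i) (expMeanLogSU (n := Fin 2))) j W b : Matrix.specialUnitaryGroup (Fin 2) ℂ) : Matrix (Fin 2) (Fin 2) ℂ)) :=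
      funext fun b => by rw [hℓ j (by omega) b]
    rw [hΛs j (by omega) z, hfun]
  have h := sqrt_sum_normSq_gaugeReduced_sub_lineIter_le W A Q hQ0 hQs Λ hΛ0 S hS0 hSs a ha0 hkst hΛs' hα ha24 haN
  simpa only [← hℓ k hk] using h


/-! ## §3 ★★ The d = 3 member with the GEOMETRIC loop sizes of the tower discharged from `RegPr`: member-uniform constants -/

set_option maxHeartbeats 400000 in
-- HEARTBEAT rule (README): the window∕geometric-sum arithmetic of this corollary measures ≈ 110–130k heartbeats; budget at twice the margin, decl-local.
/-- ★★ **THE SAME WITH NO DISPLAYED ROW: member-UNIFORM constants.**  Under the hypotheses of `sqrt_sum_normSq_frameReduced_sub_lineIter_le_T3` minus the loop-size rows, with the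
GEOMETRIC per-level loop sizes of the background tower `a j := stokes·2ε₀·(Lʲ∕L^{K−n})²` ([Balaban1985Averaging] Prop. 2 (53) = ✓`tower_plaq_lt` ∘ lattice Stokes ✓`dist1_loopHol_le'`,
`stokes = ((d+2)L)²∕4`) — so that `Σ_{j<k} a j ≤ stokes·2ε₀∕(L²−1) ≤ B := ((d+2)L)²ε₀∕16` for EVERY `k ≤ K − n` — DEFECT's two rows read
`ρ·√(Σ_c‖(ℓ_kA − PΛ_k)(c) − S k c‖²) ≤ ρ^k·κ·B·e^{κB∕ρ}·√(Σ_b‖A b‖²)` and `√(Σ_c‖(ℓ_kA − PΛ_k)(c)‖²) ≤ ρ^k·e^{κB∕ρ}·√(Σ_b‖A b‖²)`, `ρ = √((L^d)⁻¹L²)` (`= L^{−1∕2}` at d = 3),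
`κ = 159(d+2)L·√((2dL^d)(2d))`: the constants depend on `d = 3`, `L`, `ε₀` only (NOT on `K − n`).  With `ρ² = L^{2−d}`, `ρ^{2k} = ℓ^{2−d}` (`ℓ = L^k`) this is the consumer's
`ℓ^{2d}·Σ_c‖G − S‖² ≤ (κBe^{κB∕ρ}∕ρ)²·ℓ^{d+2}·Σ‖A‖²` currency.
[cite: Balaban1985Averaging, Prop. 2 (53) p.26, Prop. 3 (124)-(126) p.36; Balaban1984PropagatorsI, (1.18)-(1.20) pp.19-20; Balaban1987RG1, (0.4) p.253] -/
theorem sqrt_sum_normSq_frameReduced_sub_lineIter_le_of_regPr {ε₀ : ℝ} (hε₀ : 0 < ε₀) (hε : 10 ^ 10 * (F.L : ℝ) ^ 6 * ε₀ ≤ 1)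
    (hε12 : 10 ^ 12 * (F.L : ℝ) ^ 3 * ε₀ ≤ 1)
    (W : GaugeField (F.P K) 0 (Matrix.specialUnitaryGroup (Fin 2) ℂ)) (hreg : RegPr F n K ε₀ W)
    (Q : (k : ℕ) → (PBond (F.P K) 0 → Matrix (Fin 2) (Fin 2) ℂ) → PBond (F.P K) k → Matrix (Fin 2) (Fin 2) ℂ) (hQ0 : ∀ Y, Q 0 Y = Y)
    (hQs : ∀ (k : ℕ) (Y : PBond (F.P K) 0 → Matrix (Fin 2) (Fin 2) ℂ) (c : PBond (F.P K) (k + 1)), Q (k + 1) Y c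
      = (fderiv ℂ (eml : (Idx (F.P K) → Matrix (Fin 2) (Fin 2) ℂ) → Matrix (Fin 2) (Fin 2) ℂ)
            (fun i => ((loopHol (Averaging.iter (fun i => blockAvg (P := F.P K) (j := i) (expMeanLogSU (n := Fin 2))) k W) c i : Matrix.specialUnitaryGroup (Fin 2) ℂ) : Matrix (Fin 2) (Fin 2) ℂ))
            (fun i => covWalkSum (Averaging.iter (fun i => blockAvg (P := F.P K) (j := i) (expMeanLogSU (n := Fin 2))) k W) (Q k Y)
                (walk (emb c.src) (loopWord (F.P K).L c.dir (off i.1) i.2.1 i.2.2))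
              * ((loopHol (Averaging.iter (fun i => blockAvg (P := F.P K) (j := i) (expMeanLogSU (n := Fin 2))) k W) c i : Matrix.specialUnitaryGroup (Fin 2) ℂ) : Matrix (Fin 2) (Fin 2) ℂ))
            * star ((corr (expMeanLogSU (n := Fin 2)) (Averaging.iter (fun i => blockAvg (P := F.P K) (j := i) (expMeanLogSU (n := Fin 2))) k W) c : Matrix.specialUnitaryGroup (Fin 2) ℂ) : Matrix (Fin 2) (Fin 2) ℂ)
          + ((corr (expMeanLogSU (n := Fin 2)) (Averaging.iter (fun i => blockAvg (P := F.P K) (j := i) (expMeanLogSU (n := Fin 2))) k W) c : Matrix.specialUnitaryGroup (Fin 2) ℂ) : Matrix (Fin 2) (Fin 2) ℂ)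
            * covWalkSum (Averaging.iter (fun i => blockAvg (P := F.P K) (j := i) (expMeanLogSU (n := Fin 2))) k W) (Q k Y)
                (walk (emb c.src) (List.replicate (F.P K).L (c.dir, true)))
            * star ((corr (expMeanLogSU (n := Fin 2)) (Averaging.iter (fun i => blockAvg (P := F.P K) (j := i) (expMeanLogSU (n := Fin 2))) k W) c : Matrix.specialUnitaryGroup (Fin 2) ℂ) : Matrix (Fin 2) (Fin 2) ℂ)))
    (A : PBond (F.P K) 0 → Matrix (Fin 2) (Fin 2) ℂ) (hA : ∀ b, A b ∈ skewAdjoint (Matrix (Fin 2) (Fin 2) ℂ)) (htr : ∀ b, (A b).trace = 0)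
    (Λ : (k : ℕ) → Site (F.P K) k → Matrix (Fin 2) (Fin 2) ℂ) (hΛ0 : ∀ x, Λ 0 x = 0)
    (hΛs : ∀ (k : ℕ), k + 1 ≤ K - n → ∀ y : Site (F.P K) (k + 1),
      Λ (k + 1) y = (Fintype.card (Idx (F.P K)) : ℂ)⁻¹ • (∑ i : Idx (F.P K),
          covWalkSum (Averaging.iter (fun i => blockAvg (P := F.P K) (j := i) (expMeanLogSU (n := Fin 2))) k W)
            (fun b => (fderiv ℂ (fun t : PBond (F.P K) 0 → Matrix (Fin 2) (Fin 2) ℂ =>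
                ((emlIterU k (fun b' => expUnit (t b') * bgUnits F K W b') b : (Matrix (Fin 2) (Fin 2) ℂ)ˣ) : Matrix (Fin 2) (Fin 2) ℂ)) 0 A
              * star ((Averaging.iter (fun i => blockAvg (P := F.P K) (j := i) (expMeanLogSU (n := Fin 2))) k W b : Matrix.specialUnitaryGroup (Fin 2) ℂ) : Matrix (Fin 2) (Fin 2) ℂ))
              - (Λ k b.src - ((Averaging.iter (fun i => blockAvg (P := F.P K) (j := i) (expMeanLogSU (n := Fin 2))) k W b : Matrix.specialUnitaryGroup (Fin 2) ℂ) : Matrix (Fin 2) (Fin 2) ℂ) * Λ k b.tgt * star ((Averaging.iter (fun i => blockAvg (P := F.P K) (j := i) (expMeanLogSU (n := Fin 2))) k W b : Matrix.specialUnitaryGroup (Fin 2) ℂ) : Matrix (Fin 2) (Fin 2) ℂ)))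
            (walk (emb y) (stairWord i.2.1 (off i.1))))
        + Λ k (emb y))
    (S : (k : ℕ) → PBond (F.P K) k → Matrix (Fin 2) (Fin 2) ℂ) (hS0 : ∀ b, S 0 b = A b)
    (hSs : ∀ (k : ℕ) (c : PBond (F.P K) (k + 1)), S (k + 1) c
      = ((Fintype.card (Idx (F.P K)) : ℂ))⁻¹ • ∑ i : Idx (F.P K),
          (((holAt (Averaging.iter (fun i => blockAvg (P := F.P K) (j := i) (expMeanLogSU (n := Fin 2))) k W) (walk (emb c.src) (stairWord i.2.1 (off i.1))) : Matrix.specialUnitaryGroup (Fin 2) ℂ) : Matrix (Fin 2) (Fin 2) ℂ) *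
            covWalkSum (Averaging.iter (fun i => blockAvg (P := F.P K) (j := i) (expMeanLogSU (n := Fin 2))) k W) (S k)
              (walk (walkEnd (emb c.src) (stairWord i.2.1 (off i.1))) (List.replicate (F.P K).L (c.dir, true))) *
          star ((holAt (Averaging.iter (fun i => blockAvg (P := F.P K) (j := i) (expMeanLogSU (n := Fin 2))) k W) (walk (emb c.src) (stairWord i.2.1 (off i.1))) : Matrix.specialUnitaryGroup (Fin 2) ℂ) : Matrix (Fin 2) (Fin 2) ℂ)))
    {k : ℕ} (hk : k ≤ K - n) :
    Real.sqrt ((((F.P K).L : ℝ) ^ (F.P K).d)⁻¹ * ((F.P K).L : ℝ) ^ 2) * Real.sqrt (∑ c : PBond (F.P K) k, ‖((fderiv ℂ (fun t : PBond (F.P K) 0 → Matrix (Fin 2) (Fin 2) ℂ =>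
                ((emlIterU k (fun b' => expUnit (t b') * bgUnits F K W b') c : (Matrix (Fin 2) (Fin 2) ℂ)ˣ) : Matrix (Fin 2) (Fin 2) ℂ)) 0 A
              * star ((Averaging.iter (fun i => blockAvg (P := F.P K) (j := i) (expMeanLogSU (n := Fin 2))) k W c : Matrix.specialUnitaryGroup (Fin 2) ℂ) : Matrix (Fin 2) (Fin 2) ℂ)) - (Λ k c.src - ((Averaging.iter (fun i => blockAvg (P := F.P K) (j := i) (expMeanLogSU (n := Fin 2))) k W c : Matrix.specialUnitaryGroup (Fin 2) ℂ) : Matrix (Fin 2) (Fin 2) ℂ) * Λ k c.tgt * star ((Averaging.iter (fun i => blockAvg (P := F.P K) (j := i) (expMeanLogSU (n := Fin 2))) k W c : Matrix.specialUnitaryGroup (Fin 2) ℂ) : Matrix (Fin 2) (Fin 2) ℂ))) - S k c‖ ^ 2)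
        ≤ Real.sqrt ((((F.P K).L : ℝ) ^ (F.P K).d)⁻¹ * ((F.P K).L : ℝ) ^ 2) ^ k * (159 * ((((F.P K).d + 2) * (F.P K).L : ℕ) : ℝ) * Real.sqrt (2 * (F.P K).d * ((F.P K).L : ℝ) ^ (F.P K).d * (2 * (F.P K).d)))
          * (((((F.P K).d + 2) * (F.P K).L : ℕ) : ℝ) ^ 2 / 16 * ε₀) * Real.exp ((159 * ((((F.P K).d + 2) * (F.P K).L : ℕ) : ℝ) * Real.sqrt (2 * (F.P K).d * ((F.P K).L : ℝ) ^ (F.P K).d * (2 * (F.P K).d)))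
              / Real.sqrt ((((F.P K).L : ℝ) ^ (F.P K).d)⁻¹ * ((F.P K).L : ℝ) ^ 2) * (((((F.P K).d + 2) * (F.P K).L : ℕ) : ℝ) ^ 2 / 16 * ε₀)) * Real.sqrt (∑ b : PBond (F.P K) 0, ‖A b‖ ^ 2)
      ∧ Real.sqrt (∑ c : PBond (F.P K) k, ‖((fderiv ℂ (fun t : PBond (F.P K) 0 → Matrix (Fin 2) (Fin 2) ℂ =>
                ((emlIterU k (fun b' => expUnit (t b') * bgUnits F K W b') c : (Matrix (Fin 2) (Fin 2) ℂ)ˣ) : Matrix (Fin 2) (Fin 2) ℂ)) 0 A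
              * star ((Averaging.iter (fun i => blockAvg (P := F.P K) (j := i) (expMeanLogSU (n := Fin 2))) k W c : Matrix.specialUnitaryGroup (Fin 2) ℂ) : Matrix (Fin 2) (Fin 2) ℂ)) - (Λ k c.src - ((Averaging.iter (fun i => blockAvg (P := F.P K) (j := i) (expMeanLogSU (n := Fin 2))) k W c : Matrix.specialUnitaryGroup (Fin 2) ℂ) : Matrix (Fin 2) (Fin 2) ℂ) * Λ k c.tgt * star ((Averaging.iter (fun i => blockAvg (P := F.P K) (j := i) (expMeanLogSU (n := Fin 2))) k W c : Matrix.specialUnitaryGroup (Fin 2) ℂ) : Matrix (Fin 2) (Fin 2) ℂ)))‖ ^ 2)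
        ≤ Real.sqrt ((((F.P K).L : ℝ) ^ (F.P K).d)⁻¹ * ((F.P K).L : ℝ) ^ 2) ^ k * Real.exp ((159 * ((((F.P K).d + 2) * (F.P K).L : ℕ) : ℝ) * Real.sqrt (2 * (F.P K).d * ((F.P K).L : ℝ) ^ (F.P K).d * (2 * (F.P K).d)))
              / Real.sqrt ((((F.P K).L : ℝ) ^ (F.P K).d)⁻¹ * ((F.P K).L : ℝ) ^ 2) * (((((F.P K).d + 2) * (F.P K).L : ℕ) : ℝ) ^ 2 / 16 * ε₀)) * Real.sqrt (∑ b : PBond (F.P K) 0, ‖A b‖ ^ 2) := by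
  -- letters and windows (as in ✓`tower_loop_rows_of_regPr`)
  have hL3 : (3 : ℝ) ≤ (F.L : ℝ) := by
    have h : 3 ≤ F.L := by obtain ⟨a, ha⟩ := F.hL.1; have := F.hL.2; omega
    exact_mod_cast h
  have hL1 : (1 : ℝ) ≤ F.L := by linarith
  have hPL : ((F.P K).L : ℝ) = F.L := rfl
  have hd : (F.P K).d = 3 := T3Family.P_d F K
  have hδ : deltaSU (Fin 2) = 1 / 3 := by
    unfold deltaSU
    rw [Fintype.card_fin]
    refine min_eq_left ?_
    rw [le_div_iff₀ (by norm_num)]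
    have := Real.pi_gt_three; push_cast; linarith
  have hL6 : (F.L : ℝ) ^ 2 ≤ (F.L : ℝ) ^ 6 := pow_le_pow_right₀ hL1 (by norm_num)
  have hL2ε : (F.L : ℝ) ^ 2 * ε₀ ≤ 1 / 10 ^ 10 := by
    rw [le_div_iff₀ (by positivity)]; nlinarith [hε₀.le, hL6]
  have hε1 : ε₀ ≤ 1 / 10 ^ 10 := by
    have h9 : (9 : ℝ) ≤ (F.L : ℝ) ^ 2 := by nlinarith
    have : ε₀ ≤ (F.L : ℝ) ^ 2 * ε₀ := by nlinarith [hε₀.le]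
    exact this.trans hL2ε
  have hconst : ((((F.P K).d + 2) * (F.P K).L : ℕ) : ℝ) ^ 2 / 4 * (2 * ε₀) = 25 / 2 * ((F.L : ℝ) ^ 2 * ε₀) := by
    rw [hd]; push_cast; rw [hPL]; ring
  -- the geometric loop sizes of the tower
  set a : ℕ → ℝ := fun j => ((((F.P K).d + 2) * (F.P K).L : ℕ) : ℝ) ^ 2 / 4
      * (2 * ε₀ * (((F.P K).L : ℝ) ^ j * (((F.P K).L : ℝ) ^ (K - n))⁻¹) ^ 2) with ha_def
  have ha0 : ∀ j, 0 ≤ a j := fun j => by rw [ha_def, hPL]; positivity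
  have hU : PlaqSmall (ε₀ * ((((F.P K).L : ℝ) ^ (K - n))⁻¹) ^ 2) W := by
    intro q
    have h1 := hreg.plaqSmall q
    have h2 : regThreshold F n K ε₀ = ε₀ * ((((F.P K).L : ℝ) ^ (K - n))⁻¹) ^ 2 := by
      rw [regThreshold, hPL, inv_pow, inv_pow, mul_comm 2 (K - n), pow_mul]
    rwa [h2] at h1
  have hε3 : (143 * (((((F.P K).d + 4 : ℕ) : ℝ)) ^ 2 / 4) ^ 2) * ε₀ ≤ 1 / 3 := by
    rw [hd]; push_cast; nlinarith [hε1]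
  have hε2 : 2 * ε₀ ≤ 2 * deltaSU (Fin 2) / ((((F.P K).d + 4) * (F.P K).L : ℕ) : ℝ) ^ 2 := by
    rw [hδ, hd]; push_cast; rw [hPL]
    rw [le_div_iff₀ (by positivity)]
    nlinarith [hL2ε]
  have hx : ∀ j ≤ K - n, 0 ≤ ((F.P K).L : ℝ) ^ j * (((F.P K).L : ℝ) ^ (K - n))⁻¹ ∧ ((F.P K).L : ℝ) ^ j * (((F.P K).L : ℝ) ^ (K - n))⁻¹ ≤ 1 := by
    intro j hj
    refine ⟨by rw [hPL]; positivity, ?_⟩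
    rw [hPL, mul_inv_le_iff₀ (by positivity), one_mul]; exact pow_le_pow_right₀ hL1 hj
  have hale : ∀ j < k, a j ≤ ((((F.P K).d + 2) * (F.P K).L : ℕ) : ℝ) ^ 2 / 4 * (2 * ε₀) := by
    intro j hj
    obtain ⟨hx0, hx1⟩ := hx j (by omega)
    have : 2 * ε₀ * (((F.P K).L : ℝ) ^ j * (((F.P K).L : ℝ) ^ (K - n))⁻¹) ^ 2 ≤ 2 * ε₀ :=
      mul_le_of_le_one_right (by positivity) (pow_le_one₀ hx0 hx1)
    exact mul_le_mul_of_nonneg_left this (by positivity)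
  have hα : ∀ j < k, ∀ (c : PBond (F.P K) (j + 1)) (i : Idx (F.P K)),
      dist1 (loopHol (Averaging.iter (fun i => blockAvg (P := F.P K) (j := i) (expMeanLogSU (n := Fin 2))) j W) c i) ≤ a j := by
    intro j hj c i
    have hpl : PlaqSmall (2 * ε₀ * (((F.P K).L : ℝ) ^ j * (((F.P K).L : ℝ) ^ (K - n))⁻¹) ^ 2)
        (Averaging.iter (fun i => blockAvg (P := F.P K) (j := i) (expMeanLogSU (n := Fin 2))) j W) :=
      fun q => (tower_plaq_lt (K - n) hε₀ hε3 hε2 hU (by omega : j ≤ K - n) q).1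
    exact LatticeWordStokes.dist1_loopHol_le (by have := (hx j (by omega)).1; positivity) hpl c i
  have ha24 : ∀ j < k, a j ≤ 1 / 24 := fun j hj => (hale j hj).trans (by rw [hconst]; nlinarith [hL2ε])
  have haN : ∀ j < k, a j < deltaSU (Fin 2) := fun j hj => (hale j hj).trans_lt (by rw [hconst, hδ]; nlinarith [hL2ε])
  -- the geometric level sum: `Σ_{j<k} a j ≤ stokes·2ε₀∕(L² − 1) ≤ B`
  have hsum : ∑ j ∈ Finset.range k, a j ≤ (((((F.P K).d + 2) * (F.P K).L : ℕ) : ℝ) ^ 2 / 16 * ε₀) := by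
    have hq1 : (1 : ℝ) < (F.L : ℝ) ^ 2 := by nlinarith
    have hgeom : ∑ j ∈ Finset.range k, ((F.L : ℝ) ^ 2) ^ j = (((F.L : ℝ) ^ 2) ^ k - 1) / ((F.L : ℝ) ^ 2 - 1) :=
      geom_sum_eq hq1.ne' k
    have hratio : ∑ j ∈ Finset.range k, (((F.P K).L : ℝ) ^ j * (((F.P K).L : ℝ) ^ (K - n))⁻¹) ^ 2 ≤ 1 / 8 := by
      rw [hPL]
      have hrw : ∀ j, ((F.L : ℝ) ^ j * ((F.L : ℝ) ^ (K - n))⁻¹) ^ 2 = ((F.L : ℝ) ^ 2) ^ j * (((F.L : ℝ) ^ 2) ^ (K - n))⁻¹ := by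
        intro j; rw [mul_pow, inv_pow, ← pow_mul, ← pow_mul, mul_comm j 2, mul_comm (K - n) 2, pow_mul, pow_mul]
      simp_rw [hrw]
      rw [← Finset.sum_mul, hgeom]
      have hqK : ((F.L : ℝ) ^ 2) ^ k ≤ ((F.L : ℝ) ^ 2) ^ (K - n) := pow_le_pow_right₀ hq1.le hk
      have hqKpos : 0 < ((F.L : ℝ) ^ 2) ^ (K - n) := by positivity
      rw [div_mul_eq_mul_div, div_le_iff₀ (by nlinarith : (0 : ℝ) < ((F.L : ℝ) ^ 2 - 1)), mul_inv_le_iff₀ hqKpos]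
      have h8 : (8 : ℝ) ≤ (F.L : ℝ) ^ 2 - 1 := by nlinarith
      nlinarith
    calc ∑ j ∈ Finset.range k, a j
        = ((((F.P K).d + 2) * (F.P K).L : ℕ) : ℝ) ^ 2 / 4 * (2 * ε₀)
            * ∑ j ∈ Finset.range k, (((F.P K).L : ℝ) ^ j * (((F.P K).L : ℝ) ^ (K - n))⁻¹) ^ 2 := by
          rw [Finset.mul_sum]; refine Finset.sum_congr rfl fun j _ => ?_; rw [ha_def]; ring
      _ ≤ ((((F.P K).d + 2) * (F.P K).L : ℕ) : ℝ) ^ 2 / 4 * (2 * ε₀) * (1 / 8) :=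
          mul_le_mul_of_nonneg_left hratio (by positivity)
      _ = (((((F.P K).d + 2) * (F.P K).L : ℕ) : ℝ) ^ 2 / 16 * ε₀) := by ring
  -- the displayed-row theorem, then monotonicity in the level sum
  obtain ⟨h1, h2⟩ := sqrt_sum_normSq_frameReduced_sub_lineIter_le_T3 F hε₀ hε hε12 W hreg Q hQ0 hQs A hA htr Λ hΛ0 hΛs S hS0 hSs
    a ha0 hk hα ha24 haN
  have hA0 : 0 ≤ ∑ j ∈ Finset.range k, a j := Finset.sum_nonneg fun j _ => ha0 j
  constructor
  · refine h1.trans ?_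
    gcongr
  · refine h2.trans ?_
    gcongr

end T3

end Summit.QuantumFields.YangMills.Theorems.Prop7TrueLinIterDefectOfStairGauge

end
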